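import Literature.Geometry.Kaehler.ComplexTorusWithoutSubvarieties
import Literature.Geometry.Kaehler.ComplexTorusAnalyticCycleClassPushforward
import HarnessLib

/-!
# "No proper analytic subset of positive dimension" is an isogeny invariant of complex tori

Layer `Literature/Geometry/Kaehler`, namespace `Literature.Geometry.Kaehler.ComplexTorus`; lane `lit-hodgefound` (Track 2
foundations library), Layer A4, rider to row A4-111 of `run/shared/lean/pub/lit-hodgefound/SKELETON.md` (seat skel-4). Sequel of
`ComplexTorusWithoutSubvarieties.lean` (`AnalyticSubsetsFinite Φ ⟺` no closed analytic subset of pure dimension `d`,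
`0 < d < g`) and of prover p07's `ComplexTorusAnalyticCycleClassPushforward.lean` / `…Isogeny.lean` (an isogeny
`f = ρ(A) : X → X'` is a finite surjective local biholomorphism: `f⁻¹Z'` and `f(Z)` are closed analytic of the same pure
dimension as `Z'`, `Z` — Fulton §1.4, Chirka §2.3).

* `IsIsogeny.forall_not_hasPureDim_iff` — `X` has no closed analytic subset of pure dimension `d` iff `X'` has none;
* **`IsIsogeny.analyticSubsetsFinite_iff`, `IsIsogenous.analyticSubsetsFinite_iff`** — Voisin's assumption (b) is an
  ISOGENY INVARIANT: every closed analytic `Z ≠ X` is finite iff the same holds on any isogenous torus;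
* consequences: every torus isogenous to a Hodge-generic torus (`analyticSubsetsFinite_of_isIsogenous_of_hodgeGroup_eq_top`),
  to Zucker's `T₀` (`Zucker.analyticSubsetsFinite_of_isIsogenous`) or to the explicit torus of Weil type
  (`Weil.analyticSubsetsFinite_of_isIsogenous`) contains no proper closed analytic subset of positive dimension.

Ueno (LNM 439 §10) phrases the structure theory of subvarieties up to isogeny/finite covers (Thm. 10.9: "there exist
finite unramified coverings `B̃` and `W̃` of `B` and `W` … such that `B̃ = A₁ × W̃`"); Lange (2023), §1.1.2: isogenies are
the surjective homomorphisms with finite kernel, an equivalence relation (Cor. 1.1.16).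

Theorems only: no definition, no named fact, no instance, no notation.

## References

* [Lange2023AbelianVarietiesComplex] H. Lange, *Abelian Varieties over the Complex Numbers* (2023), §1.1.2 (isogenies),
  Lemma 1.1.11, Prop. 1.1.15, Cor. 1.1.16.
* [Fulton1998] W. Fulton, *Intersection Theory* (1998), §1.4 (proper push-forward: the image of a subvariety under a
  finite surjective morphism is a subvariety of the same dimension).
* [Ueno1975] K. Ueno, LNM 439 (1975), §10 Thm. 10.9.
* [Chirka1989] E. M. Chirka, *Complex Analytic Sets* (1989), §2.1, §2.3.
* [Voisin2002KaehlerCounterexample] C. Voisin, IMRN 2002 no. 20, §2 (b).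
-/

noncomputable section

open scoped Manifold
open Complex Module Set Function

universe u v

namespace Literature.Geometry.Kaehler

namespace ComplexTorus

section Isogeny

variable {ι ι' : Type*} [Fintype ι] [Fintype ι'] {E : Type u} {E' : Type v}
  [NormedAddCommGroup E] [NormedSpace ℂ E] [NormedAddCommGroup E'] [NormedSpace ℂ E']
  [FiniteDimensional ℂ E] [FiniteDimensional ℂ E'] (Φ : (ι → ℝ) ≃L[ℝ] E) (Φ' : (ι' → ℝ) ≃L[ℝ] E') {A : Matrix ι' ι ℤ}

omit [FiniteDimensional ℂ E'] in
/-- **Under an isogeny `f : X → X'`, `X` has a closed analytic subset of pure dimension `d` iff `X'` has one**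
(`f⁻¹Z'` and `f(Z)` have the pure dimension of `Z'`, `Z`). [cite: Fulton1998, §1.4 (p. 11)] [cite: Chirka1989, §2.3] -/
theorem IsIsogeny.forall_not_hasPureDim_iff (h : IsIsogeny Φ Φ' A) {d : ℕ} :
    (∀ Z : Set (ComplexTorus Φ), ¬ HasPureDim 𝓘(ℂ, E) Z d) ↔
      ∀ Z' : Set (ComplexTorus Φ'), ¬ HasPureDim 𝓘(ℂ, E') Z' d :=
  ⟨fun hX _ hZ' ↦ hX _ (h.hasPureDim_preimage Φ Φ' hZ'), fun hX' _ hZ ↦ hX' _ (h.hasPureDim_image Φ Φ' hZ)⟩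

/-- **"EVERY CLOSED ANALYTIC `Z ≠ X` IS FINITE" IS INVARIANT UNDER ISOGENIES**: for an isogeny `f : X → X'`,
`AnalyticSubsetsFinite Φ ↔ AnalyticSubsetsFinite Φ'` (both sides say: no closed analytic subset of pure dimension `d`,
`0 < d < g = g'`). [cite: Lange2023AbelianVarietiesComplex, §1.1.2 Lemma 1.1.11 and Prop. 1.1.15] [cite: Fulton1998, §1.4 (p. 11)]
[cite: Voisin2002KaehlerCounterexample, §2 (b)] -/
theorem IsIsogeny.analyticSubsetsFinite_iff (h : IsIsogeny Φ Φ' A) : AnalyticSubsetsFinite Φ ↔ AnalyticSubsetsFinite Φ' := by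
  rw [analyticSubsetsFinite_iff_forall_not_hasPureDim Φ, analyticSubsetsFinite_iff_forall_not_hasPureDim Φ',
    h.finrank_eq Φ Φ']
  exact forall₃_congr fun d _ _ ↦ h.forall_not_hasPureDim_iff Φ Φ'

/-- **Isogenous complex tori have, or lack, proper positive-dimensional closed analytic subsets together.**
[cite: Lange2023AbelianVarietiesComplex, §1.1.2 Cor. 1.1.16] [cite: Fulton1998, §1.4 (p. 11)] -/
theorem IsIsogenous.analyticSubsetsFinite_iff (h : IsIsogenous Φ Φ') : AnalyticSubsetsFinite Φ ↔ AnalyticSubsetsFinite Φ' := by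
  obtain ⟨A, hA⟩ := h
  exact hA.analyticSubsetsFinite_iff Φ Φ'

/-- **Every torus isogenous to a Hodge-generic torus (`Hg(X') = SL(V')`) contains no proper closed analytic subset of
positive dimension** (row A4-109 + isogeny invariance). [cite: Lange2023AbelianVarietiesComplex, §7.2.2 Thm. 7.2.4 and §1.1.2 Cor. 1.1.16] -/
theorem analyticSubsetsFinite_of_isIsogenous_of_hodgeGroup_eq_top [DecidableEq ι'] (h : IsIsogenous Φ Φ')
    (h' : hodgeGroup Φ' = ⊤) :
    AnalyticSubsetsFinite Φ :=
  (h.analyticSubsetsFinite_iff Φ Φ').2 (analyticSubsetsFinite_of_hodgeGroup_eq_top Φ' h')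

end Isogeny

end ComplexTorus

/-! ### Tori isogenous to Zucker's `T₀` or to the explicit torus of Weil type -/

namespace Zucker

open ComplexTorus

/-- **Every complex torus isogenous to Zucker's `T₀ = ℂ²/L₀` contains no analytic curve** — indeed no proper closed analytic
subset of positive dimension (row A4-111's `Zucker.analyticSubsetsFinite` transported along the isogeny; e.g. all quotients
`T₀/G` by finite subgroups and all tori covering `T₀` finitely). [cite: Zucker1977, Appendix B Theorem p. 208]
[cite: Lange2023AbelianVarietiesComplex, §1.1.2 Cor. 1.1.16] -/
theorem analyticSubsetsFinite_of_isIsogenous {ι : Type*} [Fintype ι] {E : Type u} [NormedAddCommGroup E]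
    [NormedSpace ℂ E] [FiniteDimensional ℂ E] {Φ : (ι → ℝ) ≃L[ℝ] E} (h : IsIsogenous Φ skewPeriodCLE) :
    AnalyticSubsetsFinite Φ :=
  (h.analyticSubsetsFinite_iff Φ skewPeriodCLE).2 analyticSubsetsFinite

/-- … hence such a torus is simple and not an abelian surface. [cite: Zucker1977, Appendix B Theorem p. 208]
[cite: Ueno1975, §10 Thm. 10.3 and Thm. 10.9] -/
theorem isSimple_and_not_isAbelianVariety_of_isIsogenous {ι : Type*} [Fintype ι] [DecidableEq ι] {E : Type u}
    [NormedAddCommGroup E] [NormedSpace ℂ E] [FiniteDimensional ℂ E] {Φ : (ι → ℝ) ≃L[ℝ] E}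
    (h : IsIsogenous Φ skewPeriodCLE) : IsSimple Φ ∧ ¬ IsAbelianVariety Φ := by
  obtain ⟨A, hA⟩ := h
  have hg : finrank ℂ E = 2 := by rw [hA.finrank_eq Φ skewPeriodCLE]; simp
  exact (analyticSubsetsFinite_of_isIsogenous ⟨A, hA⟩).isSimple_and_not_isAbelianVariety (by omega)

end Zucker

namespace Weil

open ComplexTorus

/-- **Every complex torus isogenous to the explicit torus of Weil type `ℂ⁴/Φ(ℤ⁸)` contains no proper closed analytic subset
of positive dimension** (row A4-108's `Weil.analyticSubsetsFinite`, transported). [cite: Voisin2002KaehlerCounterexample, §2 (b) and §3 Prop. 3]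
[cite: Lange2023AbelianVarietiesComplex, §1.1.2 Cor. 1.1.16] -/
theorem analyticSubsetsFinite_of_isIsogenous {ι : Type*} [Fintype ι] {E : Type u} [NormedAddCommGroup E]
    [NormedSpace ℂ E] [FiniteDimensional ℂ E] {Φ : (ι → ℝ) ≃L[ℝ] E} (h : IsIsogenous Φ periodEquiv) :
    AnalyticSubsetsFinite Φ :=
  (h.analyticSubsetsFinite_iff Φ periodEquiv).2 analyticSubsetsFinite

end Weil

end Literature.Geometry.Kaehler

end
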